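/-
Public-audit package `pub-balaban` (b2b-balaban), surge lineage pv26, gen 12.
Released under the Apache 2.0 licence, like Mathlib.
-/
import Literature.MathematicalPhysics.QuantumFieldTheory.Balaban1983to89.T4CubeChartExp
import Literature.MathematicalPhysics.QuantumFieldTheory.Balaban1983to89.T4TiltOscillation

/-!
# T4 — the exponential cube window against the operator-norm small-field metric `dist1`
# (caveat (WINDOW ≠ PRINT) of `T4CubeChartExp`, bond and plaquette level)

Kernel certificate, tags **[folklore]** throughout (0 `cite`): every statement below is PROVED here from Mathlib and
from the already-landed leaves `T4CubeChartExp` (the exponential cube chart `v ↦ g·exp(ι v)` of `SU(2)`, its window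
`expWindow g S = g·exp(ι [-S,S]³)`, the product window density `expWindowDensity` and the fibre chart `expFibreChart`;
lineage pv26) and `T4TiltOscillation` (lattice words, `wordHol`, `plaqWord`, the bond deviation `bdev u u₀ b = u₀(b)⁻¹ u(b)`;
lineage pv28), both used BY NAME — nothing of either is re-proved or modified.  Nothing printed is asserted and nothing
minted internally is cited (ABSOLUTE RULE).  VALUE = a kernel-checked dictionary between two notions of «small»; it is
NOT summit progress, NOT continuum, NOT Clay, and it sizes no constant of the Bałaban programme.

## What is proved

The cell's small-field vocabulary (`Setup`) is the interface metric `dist1 g = |g − 1|` of `GaugeGroup` (operator norm in the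
unitary model, `UnitaryModel`), the plaquette conditions `PlaqSmall δ U` / `PlaqSmallOn S δ U` (`dist1 (U(∂p)) < δ`) and the
indicator `chiSmall`.  The windows of `T4CubeChartExp` are sup-norm cubes in exponential coordinates about a reference
bond variable.  This file relates the two.

* §1 GROUP LEVEL (any `[GaugeGroup G]`; only the interface axioms `dist1_mul_le`, `dist1_conj`, `dist1_inv`, `dist1_one`):
  the RELATIVE first-order word bound `dist1 (U₀(w)⁻¹ U(w)) ≤ Σ_{c ∈ w} dist1 (U₀(b_c)⁻¹ U(b_c))` (`dist1_wordHol_rel_le`, the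
  sibling of `T4TiltOscillation.dist1_mul_wNew_le` with a reference configuration in place of the fibre/exterior split);
  hence `dist1 (U(∂p)) ≤ dist1 (U₀(∂p)) + plaqDev U U₀ p` with `plaqDev = Σ_{b ∈ ∂p} dist1 (U₀(b)⁻¹ U(b))` (symmetric in
  `U, U₀`, so `|dist1 U(∂p) − dist1 U₀(∂p)| ≤ plaqDev`), and BOND-SMALL ⟹ PLAQUETTE-SMALL:
  `PlaqSmallOn S₀ δ₀ U₀ → (∀ b, dist1 (U₀(b)⁻¹ U(b)) ≤ τ) → PlaqSmallOn S₀ (δ₀ + 4τ) U` (and for `PlaqSmall`, `chiSmall`).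
* §2 ONE `SU(2)` BOND: `dist1 U = ‖su2Quat U − 1‖` (the tree's isometry `T4QuatExpLog.norm_quatMatrix_sub_one`), the chord
  formula `dist1 U = 2 sin(φ/2)` with `φ = arccos (Re U₀₀) ∈ [0, π]` the rotation half-angle, and for the chart point
  `dist1 (exp(ι x)) = 2|sin(‖x‖/2)| ≤ ‖x‖` (`dist1_expPoint_eq`, `dist1_expPoint_le`); on the cube `‖toE v‖ ≤ √3·S`, so
  **`expWindow g S ⊆ {h | dist1 (g⁻¹ h) ≤ √3·S}`** (`dist1_inv_mul_le_of_mem_expWindow`; sharp form `≤ 2 sin(√3 S/2)` when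
  `√3 S ≤ π`).  CONVERSELY an explicit logarithm `logVec : ℍ → ℝ³` (`θ·(axis)`, `θ = arccos re`, the axis `e₀` at the two
  poles) with `‖logVec q‖ = arccos (re q) ≤ π` and `exp(ι (logVec q)) = q` for `|q| = 1` gives `expPoint (logVec (su2Quat U)) = U`
  — the exponential chart is ONTO from the closed ball of radius `π` (`expPoint_surjective`, `image_expPoint_closedBall`,
  `expWindow_eq_univ` for `S ≥ π`) — and **`{h | dist1 (g⁻¹ h) ≤ 2 sin(S/2)} ⊆ expWindow g S`** for `0 ≤ S`
  (`mem_expWindow_of_dist1_le`; linear form `dist1 (g⁻¹ h) ≤ 2S/π` by Jordan).  So the exponential cube window of size `S`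
  and the `dist1`-ball about `g` are two-sided comparable, radii `2 sin(S/2) ≥ 2S/π` inside and `√3·S` outside.
* §3 FIBRE / PLAQUETTES: the product window is characterised bondwise (`expWindowDensity_ne_zero_iff`, `_eq_one_iff`);
  a configuration `U` in the window about `u₀` on `s` and equal to `u₀` off `s` has every bond deviation `≤ √3·S`, hence
  every plaquette variable within `4√3·S` of that of `u₀` and `PlaqSmallOn S₀ δ₀ u₀ → PlaqSmallOn S₀ (δ₀ + 4√3·S) U`; in
  density form `expWindowDensity s u₀ S U ≤ chiSmall S₀ (δ₀ + 4√3·S) U` (EXPONENTIAL WINDOW ⊆ PLAQUETTE WINDOW); the same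
  for the fibre chart point `u₀ ← expFibreChart s u₀ e x`, `x ∈ [-S,S]ⁿ`.  Conversely bondwise `dist1 (u₀(b)⁻¹ U(b)) ≤ 2 sin(S/2)`
  on `s` (`0 ≤ S`) puts `U` in the window: `expWindowDensity s u₀ S U = 1`.

## Caveats (read before citing this file anywhere)

* (WINDOW ≠ PRINT, what remains) Bałaban's small-field condition is on PLAQUETTE variables after an axial gauge; the
  direction proved here from plaquettes is only «bond-small ⟹ plaquette-small» and «bond-small ⟹ in the window».  The
  converse «plaquette-small on a region ⟹ some gauge copy is bond-small there» (an axial-gauge / lattice Poincaré-lemma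
  statement, the content of print's claim that ONE chart covers the small-field region, (N1) of `T4CubeChartExp`) is NOT
  touched, and neither is the (β3) bookkeeping.
* (RADII) The comparison loses the dimensional factor `√3` (sup-norm cube vs Euclidean ball) outward and the chord/arc factor
  inward (`2 sin(S/2)` vs `S`); both are sharp for these shapes and no attempt is made to optimise windows.
* (RANK) `SU(2)` only in §2–§3 (`Fin 3` coordinates, unit quaternions); §1 is rank-free.
* (NO MEASURE THEORY) Nothing here concerns Haar measure, Jacobians or the transport provisos of `T4CubeChartExp` §5; the
  file is metric bookkeeping only.
-/

noncomputable section

open Set Metric NormedSpace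
open Function (updateFinset)
open scoped Real Quaternion RealInnerProductSpace

namespace Literature.MathematicalPhysics.QuantumFieldTheory.Balaban1983to89.T4ExpWindowSmallField

open Literature.MathematicalPhysics.QuantumLattice (quatMatrix su2Quat quatToSU2 quatMatrix_su2Quat norm_su2Quat
  quatToSU2_su2Quat)
open GaugeField (plaqHol)
open T4CubePoincare (cube mem_cube_iff)
open T4CubeChartGnomonic (SU2)
open T4HaarSU2ExpChart (imQuat imQuat_apply imQuat_re norm_imQuat exp_imQuat_smul norm_exp_imQuat exp_imQuat_re expPoint
  su2Quat_expPoint)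
open T4QuatExpLog (norm_quatMatrix_sub_one norm_exp_sub_one_le)
open T4CubeChartExp (toE norm_toE_sq expPt expChart expWindow expWindowDensity expFibreChart block_mem_cube
  expWindowDensity_le_one)
open T4TiltOscillation (Letter letter letter_true letter_false wordHol wordHol_nil wordHol_cons plaqWord plaqHol_eq_wordHol
  bdev bdev_self dist1_mul_comm dist1_mul_inv_eq updateFinset_apply_of_mem updateFinset_apply_of_not_mem)

/-! ## §1  Group level: relative word bound, plaquette deviation, bond-small ⟹ plaquette-small -/

section GroupLevel

variable {P : Params} {j : ℕ} {G : Type*} [GaugeGroup G]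

/-- The relative letter reads the bond deviation: `dist1 (U₀(c)⁻¹ U(c)) = dist1 (U₀(b)⁻¹ U(b))` for both orientations of
the letter `c = (b, ±)` (`dist1_mul_inv_eq` for the inverted letter). [folklore] -/
theorem dist1_letter_rel (U U₀ : GaugeField P j G) (b : PBond P j) (o : Bool) :
    dist1 ((letter U₀ (b, o))⁻¹ * letter U (b, o)) = dist1 (bdev U U₀ b) := by
  cases o
  · rw [letter_false, letter_false, inv_inv, bdev, dist1_mul_inv_eq]
  · rfl

/-- **THE RELATIVE FIRST-ORDER WORD BOUND**: `dist1 (U₀(w)⁻¹ · U(w)) ≤ Σ_{c ∈ w} dist1 (U₀(b_c)⁻¹ U(b_c))` for every word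
`w` and every pair of configurations — replace the letters one at a time; by conjugation invariance (`dist1_conj`) each
replacement costs the deviation of one bond (`dist1_mul_le`).  Sibling of `T4TiltOscillation.dist1_mul_wNew_le`. [folklore] -/
theorem dist1_wordHol_rel_le (U U₀ : GaugeField P j G) (w : List (Letter P j)) :
    dist1 ((wordHol U₀ w)⁻¹ * wordHol U w) ≤ (w.map fun c => dist1 (bdev U U₀ c.1)).sum := by
  induction w with
  | nil => simp [GaugeGroup.dist1_one]
  | cons c w ih =>
    obtain ⟨b, o⟩ := c
    simp only [wordHol_cons, List.map_cons, List.sum_cons]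
    have hconj : (letter U₀ (b, o) * wordHol U₀ w)⁻¹ * (letter U (b, o) * wordHol U w) =
        (wordHol U₀ w)⁻¹ * (((letter U₀ (b, o))⁻¹ * letter U (b, o)) * (wordHol U w * (wordHol U₀ w)⁻¹)) *
          ((wordHol U₀ w)⁻¹)⁻¹ := by
      group
    calc dist1 ((letter U₀ (b, o) * wordHol U₀ w)⁻¹ * (letter U (b, o) * wordHol U w))
        = dist1 (((letter U₀ (b, o))⁻¹ * letter U (b, o)) * (wordHol U w * (wordHol U₀ w)⁻¹)) := by
          rw [hconj, GaugeGroup.dist1_conj]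
      _ ≤ dist1 ((letter U₀ (b, o))⁻¹ * letter U (b, o)) + dist1 (wordHol U w * (wordHol U₀ w)⁻¹) :=
          GaugeGroup.dist1_mul_le _ _
      _ ≤ dist1 (bdev U U₀ b) + (w.map fun c => dist1 (bdev U U₀ c.1)).sum := by
          rw [dist1_letter_rel, dist1_mul_comm (wordHol U w)]
          exact add_le_add le_rfl ih

/-- THE PLAQUETTE DEVIATION of `U` from `U₀` at `p`: the sum of the four bond deviations around `∂p`,
`Σ_{b ∈ ∂p} dist1 (U₀(b)⁻¹ U(b))`. [folklore] -/
def plaqDev (U U₀ : GaugeField P j G) (p : Plaq P j) : ℝ :=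
  dist1 (bdev U U₀ ⟨p.src, p.μ⟩) + dist1 (bdev U U₀ ⟨p.src.shift p.μ, p.ν⟩) +
    dist1 (bdev U U₀ ⟨p.src.shift p.ν, p.μ⟩) + dist1 (bdev U U₀ ⟨p.src, p.ν⟩)

/-- `plaqDev ≥ 0`. [folklore] -/
theorem plaqDev_nonneg (U U₀ : GaugeField P j G) (p : Plaq P j) : 0 ≤ plaqDev U U₀ p := by
  unfold plaqDev
  have := GaugeGroup.dist1_nonneg (bdev U U₀ ⟨p.src, p.μ⟩)
  have := GaugeGroup.dist1_nonneg (bdev U U₀ ⟨p.src.shift p.μ, p.ν⟩)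
  have := GaugeGroup.dist1_nonneg (bdev U U₀ ⟨p.src.shift p.ν, p.μ⟩)
  have := GaugeGroup.dist1_nonneg (bdev U U₀ ⟨p.src, p.ν⟩)
  positivity

/-- `plaqDev U₀ U₀ p = 0`. [folklore] -/
@[simp] theorem plaqDev_self (U₀ : GaugeField P j G) (p : Plaq P j) : plaqDev U₀ U₀ p = 0 := by
  simp [plaqDev, GaugeGroup.dist1_one]

/-- The bond deviation is symmetric in norm: `dist1 (U₀(b)⁻¹ U(b)) = dist1 (U(b)⁻¹ U₀(b))` (`dist1_inv`). [folklore] -/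
theorem dist1_bdev_comm (U U₀ : GaugeField P j G) (b : PBond P j) : dist1 (bdev U U₀ b) = dist1 (bdev U₀ U b) := by
  rw [bdev, bdev, ← GaugeGroup.dist1_inv ((U₀ b)⁻¹ * U b), mul_inv_rev, inv_inv]

/-- `plaqDev` is symmetric in the two configurations. [folklore] -/
theorem plaqDev_comm (U U₀ : GaugeField P j G) (p : Plaq P j) : plaqDev U U₀ p = plaqDev U₀ U p := by
  simp only [plaqDev, dist1_bdev_comm U U₀]

/-- Under a uniform bond bound `dist1 (U₀(b)⁻¹ U(b)) ≤ τ`: `plaqDev U U₀ p ≤ 4τ`. [folklore] -/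
theorem plaqDev_le_four_mul {U U₀ : GaugeField P j G} {τ : ℝ} (hb : ∀ b, dist1 (bdev U U₀ b) ≤ τ) (p : Plaq P j) :
    plaqDev U U₀ p ≤ 4 * τ := by
  unfold plaqDev
  linarith [hb ⟨p.src, p.μ⟩, hb ⟨p.src.shift p.μ, p.ν⟩, hb ⟨p.src.shift p.ν, p.μ⟩, hb ⟨p.src, p.ν⟩]

/-- The relative word bound on the plaquette word: `dist1 (U₀(∂p)⁻¹ U(∂p)) ≤ plaqDev U U₀ p`. [folklore] -/
theorem dist1_plaqHol_rel_le (U U₀ : GaugeField P j G) (p : Plaq P j) :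
    dist1 ((plaqHol U₀ p)⁻¹ * plaqHol U p) ≤ plaqDev U U₀ p := by
  have h := dist1_wordHol_rel_le U U₀ (plaqWord p)
  rw [← plaqHol_eq_wordHol, ← plaqHol_eq_wordHol] at h
  simpa [plaqWord, plaqDev, add_assoc] using h

/-- **PLAQUETTE VARIABLES MOVE BY AT MOST THE PLAQUETTE DEVIATION**: `dist1 (U(∂p)) ≤ dist1 (U₀(∂p)) + plaqDev U U₀ p`.
[folklore] -/
theorem dist1_plaqHol_le_add (U U₀ : GaugeField P j G) (p : Plaq P j) :
    dist1 (plaqHol U p) ≤ dist1 (plaqHol U₀ p) + plaqDev U U₀ p :=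
  calc dist1 (plaqHol U p) = dist1 (plaqHol U₀ p * ((plaqHol U₀ p)⁻¹ * plaqHol U p)) := by rw [mul_inv_cancel_left]
    _ ≤ dist1 (plaqHol U₀ p) + dist1 ((plaqHol U₀ p)⁻¹ * plaqHol U p) := GaugeGroup.dist1_mul_le _ _
    _ ≤ dist1 (plaqHol U₀ p) + plaqDev U U₀ p := add_le_add le_rfl (dist1_plaqHol_rel_le U U₀ p)

/-- Two-sided form: `|dist1 (U(∂p)) − dist1 (U₀(∂p))| ≤ plaqDev U U₀ p`. [folklore] -/
theorem abs_dist1_plaqHol_sub_le (U U₀ : GaugeField P j G) (p : Plaq P j) :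
    |dist1 (plaqHol U p) - dist1 (plaqHol U₀ p)| ≤ plaqDev U U₀ p := by
  rw [abs_sub_le_iff]
  constructor
  · linarith [dist1_plaqHol_le_add U U₀ p]
  · linarith [dist1_plaqHol_le_add U₀ U p, plaqDev_comm U U₀ p]

/-- **BOND-SMALL ⟹ PLAQUETTE-SMALL** on a region: if `U₀` has `dist1 (U₀(∂p)) < δ₀` on `S₀` and every bond deviation of `U`
from `U₀` is `≤ τ`, then `U` has `dist1 (U(∂p)) < δ₀ + 4τ` on `S₀`. [folklore] -/
theorem plaqSmallOn_of_bdev_le {S₀ : Set (Plaq P j)} {δ₀ τ : ℝ} {U U₀ : GaugeField P j G} (h₀ : PlaqSmallOn S₀ δ₀ U₀)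
    (hb : ∀ b, dist1 (bdev U U₀ b) ≤ τ) : PlaqSmallOn S₀ (δ₀ + 4 * τ) U := fun p hp =>
  calc dist1 (plaqHol U p) ≤ dist1 (plaqHol U₀ p) + plaqDev U U₀ p := dist1_plaqHol_le_add U U₀ p
    _ < δ₀ + 4 * τ := add_lt_add_of_lt_of_le (h₀ p hp) (plaqDev_le_four_mul hb p)

/-- The same for the global condition `PlaqSmall`. [folklore] -/
theorem plaqSmall_of_bdev_le {δ₀ τ : ℝ} {U U₀ : GaugeField P j G} (h₀ : PlaqSmall δ₀ U₀) (hb : ∀ b, dist1 (bdev U U₀ b) ≤ τ) :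
    PlaqSmall (δ₀ + 4 * τ) U := fun p =>
  calc dist1 (plaqHol U p) ≤ dist1 (plaqHol U₀ p) + plaqDev U U₀ p := dist1_plaqHol_le_add U U₀ p
    _ < δ₀ + 4 * τ := add_lt_add_of_lt_of_le (h₀ p) (plaqDev_le_four_mul hb p)

/-- `0 ≤ chiSmall S₀ δ U`. [folklore] -/
theorem chiSmall_nonneg (S₀ : Set (Plaq P j)) (δ : ℝ) (U : GaugeField P j G) : 0 ≤ chiSmall S₀ δ U := by
  unfold chiSmall
  split_ifs <;> norm_num

/-- `chiSmall S₀ δ U ≤ 1`. [folklore] -/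
theorem chiSmall_le_one (S₀ : Set (Plaq P j)) (δ : ℝ) (U : GaugeField P j G) : chiSmall S₀ δ U ≤ 1 := by
  unfold chiSmall
  split_ifs <;> norm_num

/-- `chiSmall S₀ δ U = 1` on the small-field set. [folklore] -/
theorem chiSmall_eq_one {S₀ : Set (Plaq P j)} {δ : ℝ} {U : GaugeField P j G} (h : PlaqSmallOn S₀ δ U) : chiSmall S₀ δ U = 1 := by
  unfold chiSmall
  rw [if_pos h]

/-- `chiSmall S₀ δ U = 0` off the small-field set. [folklore] -/
theorem chiSmall_eq_zero {S₀ : Set (Plaq P j)} {δ : ℝ} {U : GaugeField P j G} (h : ¬ PlaqSmallOn S₀ δ U) :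
    chiSmall S₀ δ U = 0 := by
  unfold chiSmall
  rw [if_neg h]

/-- Indicator form of bond-small ⟹ plaquette-small: `χ_{S₀,δ₀}(U₀) ≤ χ_{S₀,δ₀+4τ}(U)` under the bond bound. [folklore] -/
theorem chiSmall_le_chiSmall_of_bdev_le {S₀ : Set (Plaq P j)} {δ₀ τ : ℝ} {U U₀ : GaugeField P j G}
    (hb : ∀ b, dist1 (bdev U U₀ b) ≤ τ) : chiSmall S₀ δ₀ U₀ ≤ chiSmall S₀ (δ₀ + 4 * τ) U := by
  by_cases h₀ : PlaqSmallOn S₀ δ₀ U₀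
  · rw [chiSmall_eq_one h₀, chiSmall_eq_one (plaqSmallOn_of_bdev_le h₀ hb)]
  · rw [chiSmall_eq_zero h₀]; exact chiSmall_nonneg _ _ _

end GroupLevel

/-! ## §2  One `SU(2)` bond: `dist1` through the unit quaternion, the chord formula, the window inside and outside
`dist1`-balls -/

section OneBond

open scoped Matrix.Norms.L2Operator

/-- In the cell's unitary model `dist1 U = ‖U − 1‖` (the `L²`-operator norm of the `2 × 2` matrix), by definition. [folklore] -/
theorem dist1_eq_norm_coe_sub_one (U : SU2) : dist1 U = ‖(U : Matrix (Fin 2) (Fin 2) ℂ) - 1‖ := rfl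

/-- `dist1 U = |su2Quat U − 1|` — the quaternion model is an isometry (`T4QuatExpLog.norm_quatMatrix_sub_one`). [folklore] -/
theorem dist1_eq_norm_su2Quat_sub_one (U : SU2) : dist1 U = ‖su2Quat U - 1‖ := by
  rw [dist1_eq_norm_coe_sub_one, ← norm_quatMatrix_sub_one, quatMatrix_su2Quat]

/-- For a unit quaternion `|q − 1|² = 2 − 2 re q`. [folklore] -/
theorem norm_sub_one_sq {q : ℍ} (hq : ‖q‖ = 1) : ‖q - 1‖ ^ 2 = 2 - 2 * q.re := by
  rw [@norm_sub_sq_real ℍ, hq, norm_one, Quaternion.inner_def, star_one, mul_one]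
  ring

/-- The components of a unit quaternion: `re² + imI² + imJ² + imK² = 1`. [folklore] -/
theorem sq_components_of_norm_eq_one {q : ℍ} (hq : ‖q‖ = 1) : q.re ^ 2 + q.imI ^ 2 + q.imJ ^ 2 + q.imK ^ 2 = 1 := by
  have h := Quaternion.normSq_eq_norm_mul_self q
  rw [hq, mul_one, Quaternion.normSq_def'] at h
  exact h

/-- `−1 ≤ re q` for a unit quaternion. [folklore] -/
theorem neg_one_le_re {q : ℍ} (hq : ‖q‖ = 1) : -1 ≤ q.re := by
  nlinarith [sq_components_of_norm_eq_one hq, sq_nonneg (q.re + 1), sq_nonneg q.imI, sq_nonneg q.imJ, sq_nonneg q.imK]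

/-- `re q ≤ 1` for a unit quaternion. [folklore] -/
theorem re_le_one {q : ℍ} (hq : ‖q‖ = 1) : q.re ≤ 1 := by
  nlinarith [sq_components_of_norm_eq_one hq, sq_nonneg (q.re - 1), sq_nonneg q.imI, sq_nonneg q.imJ, sq_nonneg q.imK]

/-- The half-angle identity in the form used here: `2 − 2 cos θ = (2 sin(θ/2))²`. [folklore] -/
theorem two_sub_two_mul_cos (θ : ℝ) : 2 - 2 * Real.cos θ = (2 * Real.sin (θ / 2)) ^ 2 := by
  rw [mul_pow, Real.sin_sq_eq_half_sub, show 2 * (θ / 2) = θ by ring]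
  ring

/-- **THE CHORD FORMULA** for a unit quaternion: `|q − 1| = 2 sin(φ/2)`, `φ = arccos (re q) ∈ [0, π]`. [folklore] -/
theorem norm_sub_one_eq_two_mul_sin {q : ℍ} (hq : ‖q‖ = 1) : ‖q - 1‖ = 2 * Real.sin (Real.arccos q.re / 2) := by
  have h1 : ‖q - 1‖ ^ 2 = (2 * Real.sin (Real.arccos q.re / 2)) ^ 2 := by
    rw [norm_sub_one_sq hq, ← two_sub_two_mul_cos, Real.cos_arccos (neg_one_le_re hq) (re_le_one hq)]
  have h2 : 0 ≤ 2 * Real.sin (Real.arccos q.re / 2) :=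
    mul_nonneg zero_le_two (Real.sin_nonneg_of_nonneg_of_le_pi (by linarith [Real.arccos_nonneg q.re])
      (by linarith [Real.arccos_le_pi q.re, Real.pi_pos]))
  exact (pow_left_inj₀ (norm_nonneg _) h2 two_ne_zero).1 h1

/-- `|exp(ι x) − 1| = 2|sin(‖x‖/2)|` (`re exp(ι x) = cos ‖x‖`). [folklore] -/
theorem norm_exp_imQuat_sub_one (x : EuclideanSpace ℝ (Fin 3)) : ‖exp (imQuat x) - 1‖ = 2 * |Real.sin (‖x‖ / 2)| := by
  have h1 : ‖exp (imQuat x) - 1‖ ^ 2 = (2 * Real.sin (‖x‖ / 2)) ^ 2 := by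
    rw [norm_sub_one_sq (norm_exp_imQuat x), exp_imQuat_re, two_sub_two_mul_cos]
  rw [← Real.sqrt_sq (norm_nonneg (exp (imQuat x) - 1)), h1, Real.sqrt_sq_eq_abs, abs_mul, abs_two]

/-- `dist1 (expPoint x) = |exp(ι x) − 1|`. [folklore] -/
theorem dist1_expPoint (x : EuclideanSpace ℝ (Fin 3)) : dist1 (expPoint x) = ‖exp (imQuat x) - 1‖ := by
  rw [dist1_eq_norm_su2Quat_sub_one, su2Quat_expPoint]

/-- **`dist1 (exp(ι x)) = 2|sin(‖x‖/2)|`**. [folklore] -/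
theorem dist1_expPoint_eq (x : EuclideanSpace ℝ (Fin 3)) : dist1 (expPoint x) = 2 * |Real.sin (‖x‖ / 2)| := by
  rw [dist1_expPoint, norm_exp_imQuat_sub_one]

/-- `dist1 (exp(ι x)) ≤ ‖x‖` (chord ≤ arc; tree `T4QuatExpLog.norm_exp_sub_one_le`). [folklore] -/
theorem dist1_expPoint_le (x : EuclideanSpace ℝ (Fin 3)) : dist1 (expPoint x) ≤ ‖x‖ := by
  rw [dist1_expPoint]
  exact (norm_exp_sub_one_le (imQuat_re x)).trans (norm_imQuat x).le

/-- `dist1 (expPt v) = 2|sin(‖toE v‖/2)|` for the cube-coordinate chart point of `T4CubeChartExp`. [folklore] -/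
theorem dist1_expPt_eq (v : Fin 3 → ℝ) : dist1 (expPt v) = 2 * |Real.sin (‖toE v‖ / 2)| := dist1_expPoint_eq _

/-- `dist1 (expPt v) ≤ ‖toE v‖`. [folklore] -/
theorem dist1_expPt_le (v : Fin 3 → ℝ) : dist1 (expPt v) ≤ ‖toE v‖ := dist1_expPoint_le _

/-- On the cube `[-S,S]³` the Euclidean norm is at most `√3·S`. [folklore] -/
theorem norm_toE_le_of_mem_cube {S : ℝ} {v : Fin 3 → ℝ} (hv : v ∈ cube 3 S) : ‖toE v‖ ≤ Real.sqrt 3 * S := by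
  have h := mem_cube_iff.1 hv
  have hS : 0 ≤ S := (abs_nonneg _).trans (h 0)
  have hsq : ‖toE v‖ ^ 2 ≤ (Real.sqrt 3 * S) ^ 2 := by
    rw [norm_toE_sq, mul_pow, Real.sq_sqrt (by norm_num : (0 : ℝ) ≤ 3), Fin.sum_univ_three]
    have h0 := sq_le_sq' (abs_le.1 (h 0)).1 (abs_le.1 (h 0)).2
    have h1 := sq_le_sq' (abs_le.1 (h 1)).1 (abs_le.1 (h 1)).2
    have h2 := sq_le_sq' (abs_le.1 (h 2)).1 (abs_le.1 (h 2)).2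
    linarith
  exact (pow_le_pow_iff_left₀ (norm_nonneg _) (by positivity) two_ne_zero).1 hsq

/-- `dist1 (expPt v) ≤ √3·S` on the cube `[-S,S]³`. [folklore] -/
theorem dist1_expPt_le_of_mem_cube {S : ℝ} {v : Fin 3 → ℝ} (hv : v ∈ cube 3 S) : dist1 (expPt v) ≤ Real.sqrt 3 * S :=
  (dist1_expPt_le v).trans (norm_toE_le_of_mem_cube hv)

/-- The chart about `g` read relative to `g`: `g⁻¹ · expChart g v = expPt v`. [folklore] -/
theorem inv_mul_expChart (g : SU2) (v : Fin 3 → ℝ) : g⁻¹ * expChart g v = expPt v := by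
  show g⁻¹ * (g * expPt v) = expPt v
  rw [inv_mul_cancel_left]

/-- `dist1 (g⁻¹ · expChart g v) = dist1 (expPt v)`. [folklore] -/
theorem dist1_inv_mul_expChart (g : SU2) (v : Fin 3 → ℝ) : dist1 (g⁻¹ * expChart g v) = dist1 (expPt v) := by
  rw [inv_mul_expChart]

variable {g h : SU2} {S : ℝ}

/-- **THE EXPONENTIAL WINDOW SITS INSIDE THE `dist1`-BALL OF RADIUS `√3·S`**: `h ∈ expWindow g S → dist1 (g⁻¹ h) ≤ √3·S`.
[folklore] -/
theorem dist1_inv_mul_le_of_mem_expWindow (hh : h ∈ expWindow g S) : dist1 (g⁻¹ * h) ≤ Real.sqrt 3 * S := by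
  obtain ⟨v, hv, rfl⟩ := hh
  rw [dist1_inv_mul_expChart]
  exact dist1_expPt_le_of_mem_cube hv

/-- Set form: `expWindow g S ⊆ {h | dist1 (g⁻¹ h) ≤ √3·S}`. [folklore] -/
theorem expWindow_subset_dist1 (g : SU2) (S : ℝ) : expWindow g S ⊆ {h | dist1 (g⁻¹ * h) ≤ Real.sqrt 3 * S} :=
  fun _ hh => dist1_inv_mul_le_of_mem_expWindow hh

/-- The same read at the plaquette-variable level of `dist1` itself: `h ∈ expWindow g S → dist1 h ≤ dist1 g + √3·S`. [folklore] -/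
theorem dist1_le_of_mem_expWindow (hh : h ∈ expWindow g S) : dist1 h ≤ dist1 g + Real.sqrt 3 * S :=
  calc dist1 h = dist1 (g * (g⁻¹ * h)) := by rw [mul_inv_cancel_left]
    _ ≤ dist1 g + dist1 (g⁻¹ * h) := GaugeGroup.dist1_mul_le _ _
    _ ≤ dist1 g + Real.sqrt 3 * S := add_le_add le_rfl (dist1_inv_mul_le_of_mem_expWindow hh)

/-- Sharp outer radius: for `√3·S ≤ π`, `h ∈ expWindow g S → dist1 (g⁻¹ h) ≤ 2 sin(√3·S/2)` (`sin` is monotone on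
`[0, π/2]`). [folklore] -/
theorem dist1_inv_mul_le_two_mul_sin_of_mem_expWindow (hSπ : Real.sqrt 3 * S ≤ π) (hh : h ∈ expWindow g S) :
    dist1 (g⁻¹ * h) ≤ 2 * Real.sin (Real.sqrt 3 * S / 2) := by
  obtain ⟨v, hv, rfl⟩ := hh
  rw [dist1_inv_mul_expChart, dist1_expPt_eq]
  have hn := norm_toE_le_of_mem_cube hv
  have h0 : 0 ≤ ‖toE v‖ / 2 := by positivity
  rw [abs_of_nonneg (Real.sin_nonneg_of_nonneg_of_le_pi h0 (by linarith [Real.pi_pos]))]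
  exact mul_le_mul_of_nonneg_left
    (Real.sin_le_sin_of_le_of_le_pi_div_two (by linarith [Real.pi_pos]) (by linarith) (by linarith)) zero_le_two

/-! ### The converse: an explicit logarithm on the unit quaternions and the `dist1`-ball inside the window -/

/-- The imaginary vector `(imI, imJ, imK) ∈ ℝ³` of a quaternion (`ι (imVec q) = im q`). [folklore] -/
def imVec (q : ℍ) : EuclideanSpace ℝ (Fin 3) := WithLp.toLp 2 ![q.imI, q.imJ, q.imK]

/-- `(imVec q)₀ = imI q`. [folklore] -/
@[simp] theorem imVec_apply_zero (q : ℍ) : imVec q 0 = q.imI := rfl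
/-- `(imVec q)₁ = imJ q`. [folklore] -/
@[simp] theorem imVec_apply_one (q : ℍ) : imVec q 1 = q.imJ := rfl
/-- `(imVec q)₂ = imK q`. [folklore] -/
@[simp] theorem imVec_apply_two (q : ℍ) : imVec q 2 = q.imK := rfl

/-- `ι (imVec q) = im q`. [folklore] -/
theorem imQuat_imVec (q : ℍ) : imQuat (imVec q) = q.im := by
  rw [imQuat_apply]
  ext <;> simp

/-- `‖imVec q‖² = imI² + imJ² + imK²`. [folklore] -/
theorem norm_imVec_sq (q : ℍ) : ‖imVec q‖ ^ 2 = q.imI ^ 2 + q.imJ ^ 2 + q.imK ^ 2 := by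
  rw [EuclideanSpace.real_norm_sq_eq, Fin.sum_univ_three]
  simp

/-- For a unit quaternion `‖imVec q‖² = 1 − re²`. [folklore] -/
theorem norm_imVec_sq_of_norm_eq_one {q : ℍ} (hq : ‖q‖ = 1) : ‖imVec q‖ ^ 2 = 1 - q.re ^ 2 := by
  rw [norm_imVec_sq]
  linarith [sq_components_of_norm_eq_one hq]

/-- THE LOGARITHM VECTOR of a quaternion: `θ · (im q)/|im q|` with `θ = arccos (re q)`; at the two poles `im q = 0` the axis
is `e₀` (so `logVec 1 = 0`, `logVec (−1) = π e₀`).  Only its values on unit quaternions matter. [folklore] -/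
def logVec (q : ℍ) : EuclideanSpace ℝ (Fin 3) :=
  if imVec q = 0 then Real.arccos q.re • EuclideanSpace.single 0 1 else (Real.arccos q.re / ‖imVec q‖) • imVec q

/-- `‖logVec q‖ = arccos (re q)`. [folklore] -/
theorem norm_logVec (q : ℍ) : ‖logVec q‖ = Real.arccos q.re := by
  unfold logVec
  split_ifs with h
  · rw [norm_smul, Real.norm_eq_abs, abs_of_nonneg (Real.arccos_nonneg _)]
    simp
  · rw [norm_smul, Real.norm_eq_abs, abs_div, abs_of_nonneg (Real.arccos_nonneg _), abs_of_nonneg (norm_nonneg _),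
      div_mul_cancel₀ _ (norm_ne_zero_iff.2 h)]

/-- `‖logVec q‖ ≤ π`. [folklore] -/
theorem norm_logVec_le_pi (q : ℍ) : ‖logVec q‖ ≤ π := by
  rw [norm_logVec]
  exact Real.arccos_le_pi _

/-- Every coordinate of the logarithm vector is bounded by its norm: `|(logVec q)ᵢ| ≤ ‖logVec q‖` (a coordinate of a
Euclidean vector is at most its norm). [folklore] -/
theorem abs_logVec_apply_le (q : ℍ) (i : Fin 3) : |logVec q i| ≤ ‖logVec q‖ := by
  have h : |logVec q i| ^ 2 ≤ ‖logVec q‖ ^ 2 := by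
    rw [EuclideanSpace.real_norm_sq_eq, sq_abs]
    exact Finset.single_le_sum (fun j _ => sq_nonneg (logVec q j)) (Finset.mem_univ i)
  exact (pow_le_pow_iff_left₀ (abs_nonneg _) (norm_nonneg _) two_ne_zero).1 h

/-- `0 ≤ ‖logVec q‖` is automatic; the useful lower companion is `re q = cos ‖logVec q‖` for unit `q`. [folklore] -/
theorem cos_norm_logVec {q : ℍ} (hq : ‖q‖ = 1) : Real.cos ‖logVec q‖ = q.re := by
  rw [norm_logVec, Real.cos_arccos (neg_one_le_re hq) (re_le_one hq)]

/-- **`exp(ι (logVec q)) = q` FOR EVERY UNIT QUATERNION** (`exp(ι(θ ω)) = cos θ + sin θ · ι ω`, `sin (arccos re q) = |im q|`).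
[folklore] -/
theorem exp_imQuat_logVec {q : ℍ} (hq : ‖q‖ = 1) : exp (imQuat (logVec q)) = q := by
  have h1 := neg_one_le_re hq
  have h2 := re_le_one hq
  have hcomp := sq_components_of_norm_eq_one hq
  unfold logVec
  split_ifs with h
  · -- the poles: `im q = 0`, `re q = ±1`
    have hI : q.imI = 0 := by simpa using congrArg (fun x : EuclideanSpace ℝ (Fin 3) => x 0) h
    have hJ : q.imJ = 0 := by simpa using congrArg (fun x : EuclideanSpace ℝ (Fin 3) => x 1) h
    have hK : q.imK = 0 := by simpa using congrArg (fun x : EuclideanSpace ℝ (Fin 3) => x 2) h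
    have hre : 1 - q.re ^ 2 = 0 := by rw [hI, hJ, hK] at hcomp; linarith
    have he : ‖(EuclideanSpace.single 0 1 : EuclideanSpace ℝ (Fin 3))‖ = 1 := by simp
    rw [exp_imQuat_smul he, Real.cos_arccos h1 h2, Real.sin_arccos, hre, Real.sqrt_zero, zero_smul, add_zero]
    ext <;> simp [hI, hJ, hK]
  · have hn : 0 < ‖imVec q‖ := norm_pos_iff.2 h
    have hω : ‖‖imVec q‖⁻¹ • imVec q‖ = 1 := by
      rw [norm_smul, norm_inv, norm_norm, inv_mul_cancel₀ hn.ne']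
    have hsin : Real.sin (Real.arccos q.re) = ‖imVec q‖ := by
      rw [Real.sin_arccos, ← norm_imVec_sq_of_norm_eq_one hq, Real.sqrt_sq hn.le]
    rw [div_eq_mul_inv, ← smul_smul, exp_imQuat_smul hω, Real.cos_arccos h1 h2, hsin, map_smul, smul_smul,
      mul_inv_cancel₀ hn.ne', one_smul, imQuat_imVec]
    exact Quaternion.re_add_im q

/-- **THE EXPONENTIAL CHART OF `SU(2)` IS ONTO**: `expPoint (logVec (su2Quat U)) = U`. [folklore] -/
theorem expPoint_logVec (U : SU2) : expPoint (logVec (su2Quat U)) = U := by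
  show quatToSU2 (exp (imQuat (logVec (su2Quat U)))) = U
  rw [exp_imQuat_logVec (norm_su2Quat U), quatToSU2_su2Quat]

/-- `expPoint` is surjective. [folklore] -/
theorem expPoint_surjective : Function.Surjective expPoint := fun U => ⟨_, expPoint_logVec U⟩

/-- The closed ball of radius `π` already covers: `expPoint '' closedBall 0 π = univ` (the (BALL)/injectivity-radius remark of
`T4HaarSU2ExpChart` made quantitative on the surjective side). [folklore] -/
theorem image_expPoint_closedBall : expPoint '' closedBall (0 : EuclideanSpace ℝ (Fin 3)) π = univ :=
  eq_univ_of_forall fun U => ⟨logVec (su2Quat U), mem_closedBall_zero_iff.2 (norm_logVec_le_pi _), expPoint_logVec U⟩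

/-- **THE CHORD FORMULA ON `SU(2)`**: `dist1 U = 2 sin(φ(U)/2)` with `φ(U) = arccos (Re U₀₀) = ‖logVec (su2Quat U)‖ ∈ [0, π]` the
rotation half-angle. [folklore] -/
theorem dist1_eq_two_mul_sin (U : SU2) : dist1 U = 2 * Real.sin (‖logVec (su2Quat U)‖ / 2) := by
  rw [norm_logVec, dist1_eq_norm_su2Quat_sub_one, norm_sub_one_eq_two_mul_sin (norm_su2Quat U)]

/-- **THE `dist1`-BALL OF RADIUS `2 sin(S/2)` SITS INSIDE THE EXPONENTIAL WINDOW** (`0 ≤ S`; informative for `S ≤ π`):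
`dist1 (g⁻¹ h) ≤ 2 sin(S/2) → h ∈ expWindow g S` — the logarithm of `g⁻¹ h` has norm `φ ≤ π` with `2 sin(φ/2) = dist1 (g⁻¹ h)`,
so `φ ≤ S` (`sin` is monotone on `[0, π/2]`) and all its coordinates lie in `[-S, S]`. [folklore] -/
theorem mem_expWindow_of_dist1_le (hS : 0 ≤ S) (hd : dist1 (g⁻¹ * h) ≤ 2 * Real.sin (S / 2)) :
    h ∈ expWindow g S := by
  have hxπ := norm_logVec_le_pi (su2Quat (g⁻¹ * h))
  have hθ : ‖logVec (su2Quat (g⁻¹ * h))‖ ≤ S := by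
    rw [dist1_eq_two_mul_sin] at hd
    by_contra hlt
    have := Real.sin_lt_sin_of_lt_of_le_pi_div_two (x := S / 2) (y := ‖logVec (su2Quat (g⁻¹ * h))‖ / 2)
      (by linarith [Real.pi_pos]) (by linarith) (by linarith [not_le.1 hlt])
    linarith
  refine ⟨WithLp.ofLp (logVec (su2Quat (g⁻¹ * h))), mem_cube_iff.2 fun i => (abs_logVec_apply_le _ i).trans hθ, ?_⟩
  show g * expPoint (WithLp.toLp 2 (WithLp.ofLp (logVec (su2Quat (g⁻¹ * h))))) = h
  rw [WithLp.toLp_ofLp, expPoint_logVec, mul_inv_cancel_left]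

/-- Set form: `{h | dist1 (g⁻¹ h) ≤ 2 sin(S/2)} ⊆ expWindow g S` for `0 ≤ S`. [folklore] -/
theorem dist1_subset_expWindow (hS : 0 ≤ S) : {h | dist1 (g⁻¹ * h) ≤ 2 * Real.sin (S / 2)} ⊆ expWindow g S :=
  fun _ hd => mem_expWindow_of_dist1_le hS hd

/-- Beyond the injectivity radius the window is everything: `expWindow g S = SU(2)` for `S ≥ π`. [folklore] -/
theorem expWindow_eq_univ (g : SU2) (hπ : π ≤ S) : expWindow g S = univ :=
  eq_univ_of_forall fun h =>
    ⟨WithLp.ofLp (logVec (su2Quat (g⁻¹ * h))),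
      mem_cube_iff.2 fun i => ((abs_logVec_apply_le _ i).trans (norm_logVec_le_pi _)).trans hπ, by
        show g * expPoint (WithLp.toLp 2 (WithLp.ofLp (logVec (su2Quat (g⁻¹ * h))))) = h
        rw [WithLp.toLp_ofLp, expPoint_logVec, mul_inv_cancel_left]⟩

/-- Linear inner radius: `dist1 (g⁻¹ h) ≤ 2S/π → h ∈ expWindow g S` for `0 ≤ S` (Jordan `sin x ≥ (2/π) x` on `[0, π/2]`
when `S ≤ π`; for `S ≥ π` the window is everything). [folklore] -/
theorem mem_expWindow_of_dist1_le_linear (hS : 0 ≤ S) (hd : dist1 (g⁻¹ * h) ≤ 2 * S / π) : h ∈ expWindow g S := by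
  by_cases hSπ : S ≤ π
  · refine mem_expWindow_of_dist1_le hS (hd.trans ?_)
    have hj := Real.mul_le_sin (show 0 ≤ S / 2 by positivity) (by linarith)
    rw [show 2 * S / π = 2 * (2 / π * (S / 2)) by ring]
    exact mul_le_mul_of_nonneg_left hj zero_le_two
  · rw [expWindow_eq_univ g (le_of_not_ge hSπ)]
    exact mem_univ h

end OneBond

/-! ## §3  Fibre and plaquettes: the product window read bondwise, exponential window ⊆ plaquette window, and the
bondwise converse -/

section Fibre

variable {P : Params} {j : ℕ} {s : Finset (PBond P j)} {u₀ : GaugeField P j SU2} {S : ℝ} {n : ℕ}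

/-- The product window is non-zero iff every bond of `s` is in its one-bond window. [folklore] -/
theorem expWindowDensity_ne_zero_iff {U : GaugeField P j SU2} :
    expWindowDensity s u₀ S U ≠ 0 ↔ ∀ b ∈ s, U b ∈ expWindow (u₀ b) S := by
  show (∏ b ∈ s, (expWindow (u₀ b) S).indicator (fun _ => (1 : ℝ)) (U b)) ≠ 0 ↔ _
  rw [Finset.prod_ne_zero_iff]
  refine forall₂_congr fun b _ => ⟨fun hne => ?_, fun hmem => ?_⟩
  · by_contra hnot
    exact hne (Set.indicator_of_notMem hnot _)
  · rw [Set.indicator_of_mem hmem]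
    exact one_ne_zero

/-- … iff it equals `1`. [folklore] -/
theorem expWindowDensity_eq_one_iff {U : GaugeField P j SU2} :
    expWindowDensity s u₀ S U = 1 ↔ ∀ b ∈ s, U b ∈ expWindow (u₀ b) S :=
  ⟨fun h1 => expWindowDensity_ne_zero_iff.1 (by rw [h1]; exact one_ne_zero),
    fun hmem => Finset.prod_eq_one fun b hb => Set.indicator_of_mem (hmem b hb) _⟩

/-- IN THE WINDOW ⟹ BOND-SMALL: a configuration in the product window about `u₀` on `s` and equal to `u₀` off `s` has every
bond deviation `dist1 (u₀(b)⁻¹ U(b)) ≤ √3·S` (`0 ≤ S`). [folklore] -/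
theorem dist1_bdev_le_of_mem_expWindow {U : GaugeField P j SU2} (hoff : ∀ b ∉ s, U b = u₀ b)
    (hU : ∀ b ∈ s, U b ∈ expWindow (u₀ b) S) (hS : 0 ≤ S) (b : PBond P j) : dist1 (bdev U u₀ b) ≤ Real.sqrt 3 * S := by
  by_cases hb : b ∈ s
  · exact dist1_inv_mul_le_of_mem_expWindow (hU b hb)
  · rw [bdev, hoff b hb, inv_mul_cancel, GaugeGroup.dist1_one]
    positivity

/-- **EXPONENTIAL WINDOW ⟹ PLAQUETTE WINDOW**: with `U` as above and `dist1 (u₀(∂p)) < δ₀` on `S₀`,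
`dist1 (U(∂p)) < δ₀ + 4√3·S` on `S₀`. [folklore] -/
theorem plaqSmallOn_of_mem_expWindow {U : GaugeField P j SU2} (hoff : ∀ b ∉ s, U b = u₀ b)
    (hU : ∀ b ∈ s, U b ∈ expWindow (u₀ b) S) (hS : 0 ≤ S) {S₀ : Set (Plaq P j)} {δ₀ : ℝ} (h₀ : PlaqSmallOn S₀ δ₀ u₀) :
    PlaqSmallOn S₀ (δ₀ + 4 * (Real.sqrt 3 * S)) U :=
  plaqSmallOn_of_bdev_le h₀ (dist1_bdev_le_of_mem_expWindow hoff hU hS)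

/-- Every plaquette variable of such a `U` is within `4√3·S` of that of `u₀`. [folklore] -/
theorem dist1_plaqHol_le_of_mem_expWindow {U : GaugeField P j SU2} (hoff : ∀ b ∉ s, U b = u₀ b)
    (hU : ∀ b ∈ s, U b ∈ expWindow (u₀ b) S) (hS : 0 ≤ S) (p : Plaq P j) :
    dist1 (plaqHol U p) ≤ dist1 (plaqHol u₀ p) + 4 * (Real.sqrt 3 * S) :=
  (dist1_plaqHol_le_add U u₀ p).trans
    (add_le_add le_rfl (plaqDev_le_four_mul (dist1_bdev_le_of_mem_expWindow hoff hU hS) p))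

/-- **DENSITY FORM**: for `U = u₀` off `s` and `dist1 (u₀(∂p)) < δ₀` on `S₀`,
`expWindowDensity s u₀ S U ≤ chiSmall S₀ (δ₀ + 4√3·S) U` — the exponential product window is contained in the plaquette
small-field window of `Setup.chiSmall`. [folklore] -/
theorem expWindowDensity_le_chiSmall {U : GaugeField P j SU2} (hoff : ∀ b ∉ s, U b = u₀ b) (hS : 0 ≤ S)
    {S₀ : Set (Plaq P j)} {δ₀ : ℝ} (h₀ : PlaqSmallOn S₀ δ₀ u₀) :
    expWindowDensity s u₀ S U ≤ chiSmall S₀ (δ₀ + 4 * (Real.sqrt 3 * S)) U := by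
  by_cases hU : expWindowDensity s u₀ S U = 0
  · rw [hU]
    exact chiSmall_nonneg _ _ _
  · rw [chiSmall_eq_one (plaqSmallOn_of_mem_expWindow hoff (expWindowDensity_ne_zero_iff.1 hU) hS h₀)]
    exact expWindowDensity_le_one U

variable [DecidableEq (PBond P j)]

/-- THE FIBRE CHART POINT IS BOND-SMALL: for `x ∈ [-S,S]ⁿ` every bond deviation of `u₀ ← expFibreChart s u₀ e x` from `u₀` is
`≤ √3·S`. [folklore] -/
theorem dist1_bdev_expFibreChart_le (e : ↥s × Fin 3 ≃ Fin n) (hS : 0 ≤ S) {x : Fin n → ℝ} (hx : x ∈ cube n S)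
    (b : PBond P j) : dist1 (bdev (updateFinset u₀ s (expFibreChart s u₀ e x)) u₀ b) ≤ Real.sqrt 3 * S := by
  by_cases hb : b ∈ s
  · rw [bdev, updateFinset_apply_of_mem _ _ hb]
    show dist1 ((u₀ b)⁻¹ * expChart (u₀ b) fun i => x (e (⟨b, hb⟩, i))) ≤ _
    rw [dist1_inv_mul_expChart]
    exact dist1_expPt_le_of_mem_cube (block_mem_cube e hx ⟨b, hb⟩)
  · rw [bdev, updateFinset_apply_of_not_mem _ _ hb, inv_mul_cancel, GaugeGroup.dist1_one]
    positivity

/-- The fibre chart point lies in the product window (as it must): `expWindowDensity s u₀ S (u₀ ← expFibreChart s u₀ e x) = 1`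
for `x ∈ [-S,S]ⁿ`. [folklore] -/
theorem expWindowDensity_expFibreChart (e : ↥s × Fin 3 ≃ Fin n) {x : Fin n → ℝ} (hx : x ∈ cube n S) :
    expWindowDensity s u₀ S (updateFinset u₀ s (expFibreChart s u₀ e x)) = 1 :=
  expWindowDensity_eq_one_iff.2 fun b hb => by
    rw [updateFinset_apply_of_mem _ _ hb]
    exact ⟨fun i => x (e (⟨b, hb⟩, i)), block_mem_cube e hx ⟨b, hb⟩, rfl⟩

/-- Every plaquette variable of the fibre chart point is within `4√3·S` of that of `u₀`. [folklore] -/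
theorem dist1_plaqHol_expFibreChart_le (e : ↥s × Fin 3 ≃ Fin n) (hS : 0 ≤ S) {x : Fin n → ℝ} (hx : x ∈ cube n S)
    (p : Plaq P j) :
    dist1 (plaqHol (updateFinset u₀ s (expFibreChart s u₀ e x)) p) ≤ dist1 (plaqHol u₀ p) + 4 * (Real.sqrt 3 * S) :=
  (dist1_plaqHol_le_add _ u₀ p).trans
    (add_le_add le_rfl (plaqDev_le_four_mul (dist1_bdev_expFibreChart_le e hS hx) p))

/-- **THE FIBRE CHART STAYS IN THE PLAQUETTE WINDOW**: `PlaqSmallOn S₀ δ₀ u₀ → PlaqSmallOn S₀ (δ₀ + 4√3·S) (u₀ ← expFibreChart s u₀ e x)`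
for `x ∈ [-S,S]ⁿ`. [folklore] -/
theorem plaqSmallOn_expFibreChart (e : ↥s × Fin 3 ≃ Fin n) (hS : 0 ≤ S) {x : Fin n → ℝ} (hx : x ∈ cube n S)
    {S₀ : Set (Plaq P j)} {δ₀ : ℝ} (h₀ : PlaqSmallOn S₀ δ₀ u₀) :
    PlaqSmallOn S₀ (δ₀ + 4 * (Real.sqrt 3 * S)) (updateFinset u₀ s (expFibreChart s u₀ e x)) :=
  plaqSmallOn_of_bdev_le h₀ (dist1_bdev_expFibreChart_le e hS hx)

/-- … and in the global plaquette window: `PlaqSmall δ₀ u₀ → PlaqSmall (δ₀ + 4√3·S) (u₀ ← expFibreChart s u₀ e x)`. [folklore] -/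
theorem plaqSmall_expFibreChart (e : ↥s × Fin 3 ≃ Fin n) (hS : 0 ≤ S) {x : Fin n → ℝ} (hx : x ∈ cube n S) {δ₀ : ℝ}
    (h₀ : PlaqSmall δ₀ u₀) : PlaqSmall (δ₀ + 4 * (Real.sqrt 3 * S)) (updateFinset u₀ s (expFibreChart s u₀ e x)) :=
  plaqSmall_of_bdev_le h₀ (dist1_bdev_expFibreChart_le e hS hx)

omit [DecidableEq (PBond P j)] in
/-- **THE BONDWISE CONVERSE**: bond-small about `u₀` on `s` in the chord radius, `dist1 (u₀(b)⁻¹ U(b)) ≤ 2 sin(S/2)` for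
`b ∈ s` (`0 ≤ S`), puts `U` in the product window: `expWindowDensity s u₀ S U = 1`.  (What is NOT here: plaquette-small
⟹ bond-small in some gauge — caveat (WINDOW ≠ PRINT).) [folklore] -/
theorem expWindowDensity_eq_one_of_dist1_bdev_le {U : GaugeField P j SU2} (hS : 0 ≤ S)
    (hb : ∀ b ∈ s, dist1 (bdev U u₀ b) ≤ 2 * Real.sin (S / 2)) : expWindowDensity s u₀ S U = 1 :=
  expWindowDensity_eq_one_iff.2 fun b hb' => mem_expWindow_of_dist1_le hS (hb b hb')

omit [DecidableEq (PBond P j)] in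
/-- Linear form of the converse: `dist1 (u₀(b)⁻¹ U(b)) ≤ 2S/π` on `s` (`0 ≤ S`) gives `expWindowDensity s u₀ S U = 1`. [folklore] -/
theorem expWindowDensity_eq_one_of_dist1_bdev_le_linear {U : GaugeField P j SU2} (hS : 0 ≤ S)
    (hb : ∀ b ∈ s, dist1 (bdev U u₀ b) ≤ 2 * S / π) : expWindowDensity s u₀ S U = 1 :=
  expWindowDensity_eq_one_iff.2 fun b hb' => mem_expWindow_of_dist1_le_linear hS (hb b hb')

end Fibre

end Literature.MathematicalPhysics.QuantumFieldTheory.Balaban1983to89.T4ExpWindowSmallField
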